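import Literature.MathematicalPhysics.QuantumFieldTheory.Balaban1983to89.B7SectEFLinearisationRec
import Literature.MathematicalPhysics.QuantumFieldTheory.Balaban1983to89.B7Prop8PrintedConstants

/-!
# `Balaban1983to89.B7Prop8PrintedConstantsRec` — [Balaban1985Averaging] (79)–(80) p. 30 with (167) p. 44: the record's averages `\overline{R₀u}ʲ` of a UNITARY gauge function at UNITARY level backgrounds stay
# UNITARY (centred blocks, (0.4) average) — the record twin of the engine's `B7Prop8PrintedConstants.uavg_mem_unitaryUnits`

statement-level skeleton of published theorems with citation tags; proofs where landed; nothing here is a claim about the Yang–Mills mass gap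

CITATION HEADER (lean-in-tree rule).  Cell `pub-ymgap`, seat `pub-ymgap-dag-n05-e` g36 (N05-REC LEAD PEN); item R1 ([3] layer): the record twin of the class-A declaration
`B7Prop8PrintedConstants.uavg_mem_unitaryUnits` of the N05 cone (desk `N05-REC-INVENTORY.md`).  `--kind proof --supports stmt-QuantumFields-20541` (K0⁷; count-neutral; no definition).  Sources READ: [3] =
[Balaban1985Averaging] p. 30 (78)–(80), p. 44 (166)–(167), p. 21 (22)–(23) (`paper:balaban1985-cmp98-averaging`); [I] = [Balaban1987RG1] (0.3) p. 252.  REUSED BY NAME: the engine's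
`B7Prop2Explicit.star_mlog_eq_neg`, `B7Prop8PrintedConstants.Rc_mem_unitaryUnits`, `B7Prop1Explicit.hol_mem_of`, Mathlib's `NormedSpace.exp_mem_unitary_of_mem_skewAdjoint`; the record's
`B7SectCDGaugeAveragesRec.{uavgZ, R0avgZ, savgZ, SexpZ}`, `B7SectEFLinearisationRec.Cond167Z`.

WHAT IS PROVED (sorry-free).  ★`uavgZ_mem_unitaryUnits` — in a C⋆-algebra: if the level backgrounds `Ū₀ʲ` (`j < k`) and `u` are unitary and (167) holds on the centred blocks with `β·Lᵏη ≤ ¼`, then every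
`\overline{R₀u}ʲ(z)`, `j ≤ k`, is unitary (the exponent of (78) is a mean of logarithms of unitaries within `¼` of `1`, hence skew-adjoint).
HONEST SCOPE.  Bookkeeping port; nothing of [3]∕[I] asserted beyond what is proved; `HThm4Rec` UNDISCHARGED; N05 discharged of record untouched; N07 not claimable; counts unmoved (typed 28∕28 ·
discharged 8∕28); one finite 𝕋⁴ programme at fixed ε — nothing continuum ∕ ℝ⁴ ∕ OS ∕ mass gap ∕ Clay.  No `def`, no `instance`, no `notation`, no `sorry`.
-/

set_option autoImplicit false

noncomputable section

open scoped BigOperators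
open NormedSpace Finset

namespace Literature.MathematicalPhysics.QuantumFieldTheory.Balaban1983to89.B7Prop8PrintedConstantsRec

open B7Prop1Explicit hiding Site
open B7Prop1Explicit renaming Site → SiteZ
open MatrixLog B7Prop2Explicit B7Eq92Concrete
open B7Eq99Concrete (R0fun R0fun_apply R0fun_self R0fun_add)
open B7Prop8PrintedConstants (Rc_mem_unitaryUnits)
open BlockAveragingZd (avgIterZ offZ)
open B7SectCDGaugeAveragesRec (uavgZ uavgZ_zero uavgZ_succ R0avgZ savgZ SexpZ)
open B7SectEFLinearisationRec (Cond167Z)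

variable {d : ℕ}
variable {𝔸 : Type*} [CStarAlgebra 𝔸]
variable {L : ℕ} {U₀ : SiteZ d → Fin d → 𝔸ˣ} {u : SiteZ d → 𝔸ˣ} {k : ℕ} {β η : ℝ}

/-- ★ **The record's averages (79)–(80) of a unitary gauge function at unitary level backgrounds are unitary** — the record twin of the engine's `uavg_mem_unitaryUnits`: by (78)/(80) the average is
`ūʲ(Lz)·exp[Σ_{x∈B(Lz)} L^{−d} log(…)]` with the logarithms of the unitary (167)-quantities (within `β·Lᵏη ≤ ¼` of `1`) skew-adjoint ((22)–(23)). [cite: Balaban1985Averaging, (79)–(80) p.30, (167) p.44, (22)–(23) p.21; Balaban1987RG1, (0.3) p.252] -/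
theorem uavgZ_mem_unitaryUnits (hV : ∀ j < k, ∀ (x : SiteZ d) (κ : Fin d), avgIterZ L U₀ j x κ ∈ unitaryUnits 𝔸)
    (hu : ∀ x, u x ∈ unitaryUnits 𝔸) (h167 : Cond167Z L U₀ u k β η)
    (hL : 1 ≤ L) (hη : 0 ≤ η) (hβ : 0 ≤ β) (hs : β * (L : ℝ) ^ k * η ≤ 1 / 4) :
    ∀ j ≤ k, ∀ z : SiteZ d, uavgZ L U₀ u j z ∈ unitaryUnits 𝔸 := by
  have hLr : (1 : ℝ) ≤ L := by exact_mod_cast hL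
  intro j
  induction j with
  | zero =>
    intro _ z
    rw [uavgZ_zero]
    exact hu z
  | succ j ih =>
    intro hjk z
    have hjlt : j < k := Nat.lt_of_succ_le hjk
    have ihj := ih hjlt.le
    set y : SiteZ d := (L : ℤ) • z with hy
    rw [mem_unitaryUnits, uavgZ_succ]
    unfold R0avgZ savgZ
    rw [Units.val_mul, val_expUnit, R0fun_self]
    refine Submonoid.mul_mem _ ((mem_unitaryUnits).1 (ihj y)) ?_
    have hS : SexpZ L (R0fun (avgIterZ L U₀ j) y (uavgZ L U₀ u j)) y ∈ skewAdjoint 𝔸 := by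
      unfold SexpZ
      refine sum_mem fun r _ => skewAdjoint.smul_mem _ ?_
      rw [skewAdjoint.mem_iff, R0fun_self, R0fun_add]
      refine star_mlog_eq_neg ?_ ?_
      · exact (mem_unitaryUnits).1 ((unitaryUnits 𝔸).mul_mem ((unitaryUnits 𝔸).inv_mem (ihj y))
          (Rc_mem_unitaryUnits (hol_mem_of (hV j hjlt) _ _) (ihj _)))
      · calc ‖((((uavgZ L U₀ u j y)⁻¹ *
              Rc (hol (avgIterZ L U₀ j) y (treeWord (offZ L r))) (uavgZ L U₀ u j (y + offZ L r)) : 𝔸ˣ)) : 𝔸) - 1‖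
            ≤ β * (L : ℝ) ^ (j + 1) * η := h167 j hjlt z r
          _ ≤ β * (L : ℝ) ^ k * η :=
            mul_le_mul_of_nonneg_right (mul_le_mul_of_nonneg_left (pow_le_pow_right₀ hLr hjk) hβ) hη
          _ ≤ 1 / 4 := hs
    letI : NormedAlgebra ℚ 𝔸 := NormedAlgebra.restrictScalars ℚ ℂ 𝔸
    exact NormedSpace.exp_mem_unitary_of_mem_skewAdjoint hS

end Literature.MathematicalPhysics.QuantumFieldTheory.Balaban1983to89.B7Prop8PrintedConstantsRec
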